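import Summits.BirchSwinnertonDyer.BirchSwinnertonDyer.Theorems.ByReductionTypeAtTwoOrdKatoHalfAtTwoIsoRelaxedGenuineOptimal
import Summits.BirchSwinnertonDyer.BirchSwinnertonDyer.Theorems.ByReductionTypeAtTwoOrdKatoHalfAtTwoIsoOptimalOff514OptimalMember
import Summits.BirchSwinnertonDyer.BirchSwinnertonDyer.Theorems.ByReductionTypeAtTwoOrdKatoHalfAtTwoIsoRelaxedOptimalExistsMember
import HarnessLib

/-!
# VetLanded (crux-triage r1 seat 2; written GEN 44, farm-checked GEN 46) — BY-NAME, BY-IMPORT VET of the LANDED v19 stub text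
# `Summit.BirchSwinnertonDyer.BirchSwinnertonDyer.Theorems.SteinbergFibreAtTwo.RelaxedZetaOptimalAtTwoExistsMemberFlat` (the lead's p711951,
# ACCEPTED, tree `Theorems/ByReductionTypeAtTwoOrdKatoHalfAtTwoIsoRelaxedOptimalExistsMember.lean` §1) against crux-triage r1-2's certified text
# (Cert39b §1 = Cert42 §1, `Cert.R` below) THROUGH the lead's draft text (`Lead.R` below = `Vet19.lean`'s verbatim copy of the draft).
# Claims checked by the kernel: `landed_iff_lead : <tree decl> ↔ Lead.R := Iff.rfl` (the landed text IS the vetted draft text, definitionally) and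
# `landed_iff_cert` (the landed text is equivalent to the certificate text — conjunct order only). Nothing asserted about the statement itself
# (memo tier, OPEN); BSD is not proved; the crux is not proved.
-/


set_option autoImplicit false
set_option linter.dupNamespace false

noncomputable section


open scoped Classical MatrixGroups ModularForm NumberField
open CongruenceSubgroup WeierstrassCurve Field IsDedekindDomain NumberField
open Literature.NumberTheory.GaloisRepresentations
open Literature.NumberTheory.GaloisCohomology
open Literature.NumberTheory.EllipticCurves Literature.NumberTheory.EllipticCurves.ModularForms
open Literature.NumberTheory.EllipticCurves.Kato2004
  Literature.NumberTheory.EllipticCurves.Kato2004.EulerSystemValues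
open Literature.NumberTheory.EllipticCurves.Rank1Residual
  Summit.BirchSwinnertonDyer.Rank1Residual.X1.MuLambda
open Literature.NumberTheory.EllipticCurves.Greenberg1999
open Literature.NumberTheory.IwasawaTheory
open Summit.BirchSwinnertonDyer.Rank1Residual Summit.BirchSwinnertonDyer.Rank1Residual.X5
open Summit.BirchSwinnertonDyer.BirchSwinnertonDyer.Theorems.OrdKatoOptimalAtTwo
  Summit.BirchSwinnertonDyer.BirchSwinnertonDyer.Theorems.OrdKatoIntAtTwo
open Summit.BirchSwinnertonDyer.BirchSwinnertonDyer.Theses.ByReductionTypeAtTwo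
open Summit.BirchSwinnertonDyer.BirchSwinnertonDyer.Theorems.AlignedTransportAtTwoFineRoad

namespace Summit.BirchSwinnertonDyer.BirchSwinnertonDyer.Cruxes.OrdKatoHalfAtTwoIso.VetLanded

namespace Lead

/-- VERBATIM copy of the lead's draft §1 body (p711951). [folklore] -/
def R : Prop :=
  ∀ (W : WeierstrassCurve ℚ) [W.IsElliptic] [W.IsGloballyMinimal],
    ¬ W.HasCM → GoodOrd W 2 → ¬ W.HasSurjectiveModNGaloisRep 2 →
    ∃ (W₁ : WeierstrassCurve ℚ) (_ : W₁.IsElliptic) (_ : W₁.IsGloballyMinimal),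
      WeierstrassCurve.IsIsogenous W W₁ ∧
      (∀ [NeZero (W₁.conductorNorm ℤ)] (f : CuspForm (Gamma0 (W₁.conductorNorm ℤ)) 2),
        IsNewformOf W₁ f → ∀ ϖ : ℚ, (ϖ : ℝ) * W₁.realPeriodRat = plusPeriod f →
          ∃ L₀ : IwasawaAlgebra 2, iwasawaToPowerSeries 2 L₀ =
            PowerSeries.C (ϖ : ℚ_[2]) * padicLFunction f (unitRoot W₁ 2 : ℚ_[2])) ∧
      ∀ {N : ℕ} [NeZero N] (f : CuspForm (Gamma0 N) 2) (κ : ZpExtension ℚ 2) (γ : absoluteGaloisGroup ℚ),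
        κ.IsCyclotomic → κ.IsTopGenerator γ → IsCyclotomicVariable 2 γ → IsNewformOf W₁ f →
        ∀ ϖ : ℚ, (ϖ : ℝ) * W₁.realPeriodRat = plusPeriod f →
        ∀ (Dr : W₁.SelmerDualDataRelaxedInf κ γ) (Yr : W₁.FineSelmerDualDataRelaxedInf κ γ),
          ∃ (P : Submodule (IwasawaAlgebra 2) (IwasawaAlgebra 2)) (M : Submodule (IwasawaAlgebra 2) P)
            (τ : P →ₛₗ[((IwasawaAlgebra.involEquiv 2).toRingEquiv : IwasawaAlgebra 2 →+* IwasawaAlgebra 2)] Dr.X)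
            (π : Dr.X →ₗ[IwasawaAlgebra 2] Yr.X),
            (∀ m ∈ M, τ m = 0) ∧ Function.Surjective π ∧ Function.Exact τ π ∧
            ∀ L₀ : IwasawaAlgebra 2,
              iwasawaToPowerSeries 2 L₀ = PowerSeries.C (ϖ : ℚ_[2]) * padicLFunction f (unitRoot W₁ 2 : ℚ_[2]) →
                ∃ s : IwasawaAlgebra 2, s ∉ IwasawaAlgebra.augIdealP 2 ∧
                  s * (PowerSeries.C (((2 : ℕ) : ℤ_[2]) ^ (if 0 < W₁.Δ then 1 else 0)) * L₀) ∈ Submodule.map P.subtype M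

end Lead

namespace Cert

/-- VERBATIM copy of Cert42 §1 body (= Cert39b §1). [folklore] -/
def R : Prop :=
  ∀ (W : WeierstrassCurve ℚ) [W.IsElliptic] [W.IsGloballyMinimal],
    ¬ W.HasCM → GoodOrd W 2 → ¬ W.HasSurjectiveModNGaloisRep 2 →
    ∃ (W₁ : WeierstrassCurve ℚ) (_ : W₁.IsElliptic) (_ : W₁.IsGloballyMinimal),
      WeierstrassCurve.IsIsogenous W W₁ ∧
      (∀ {N : ℕ} [NeZero N] (f : CuspForm (Gamma0 N) 2) (κ : ZpExtension ℚ 2) (γ : absoluteGaloisGroup ℚ),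
        κ.IsCyclotomic → κ.IsTopGenerator γ → IsCyclotomicVariable 2 γ → IsNewformOf W₁ f →
        ∀ ϖ : ℚ, (ϖ : ℝ) * W₁.realPeriodRat = plusPeriod f →
        ∀ (Dr : W₁.SelmerDualDataRelaxedInf κ γ) (Yr : W₁.FineSelmerDualDataRelaxedInf κ γ),
          ∃ (P : Submodule (IwasawaAlgebra 2) (IwasawaAlgebra 2)) (M : Submodule (IwasawaAlgebra 2) P)
            (τ : P →ₛₗ[((IwasawaAlgebra.involEquiv 2).toRingEquiv : IwasawaAlgebra 2 →+* IwasawaAlgebra 2)] Dr.X)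
            (π : Dr.X →ₗ[IwasawaAlgebra 2] Yr.X),
            (∀ m ∈ M, τ m = 0) ∧ Function.Surjective π ∧ Function.Exact τ π ∧
            ∀ L₀ : IwasawaAlgebra 2,
              iwasawaToPowerSeries 2 L₀ =
                  PowerSeries.C (ϖ : ℚ_[2]) * padicLFunction f (unitRoot W₁ 2 : ℚ_[2]) →
                ∃ s : IwasawaAlgebra 2, s ∉ IwasawaAlgebra.augIdealP 2 ∧
                  s * (PowerSeries.C (((2 : ℕ) : ℤ_[2]) ^ (if 0 < W₁.Δ then 1 else 0)) * L₀) ∈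
                    Submodule.map P.subtype M) ∧
      ∀ [NeZero (W₁.conductorNorm ℤ)] (f : CuspForm (Gamma0 (W₁.conductorNorm ℤ)) 2),
        IsNewformOf W₁ f → ∀ ϖ : ℚ, (ϖ : ℝ) * W₁.realPeriodRat = plusPeriod f →
          ∃ L₀ : IwasawaAlgebra 2, iwasawaToPowerSeries 2 L₀ =
            PowerSeries.C (ϖ : ℚ_[2]) * padicLFunction f (unitRoot W₁ 2 : ℚ_[2])

end Cert

/-- The lead's v19 text and the triage certificate text are EQUIVALENT (conjunct swap). [folklore] -/
theorem lead_iff_cert : Lead.R ↔ Cert.R := by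
  constructor
  · intro h W _ _ hCM hgo hns
    obtain ⟨W₁, i₁, i₂, hiso, ha, hb⟩ := h W hCM hgo hns
    exact ⟨W₁, i₁, i₂, hiso, hb, ha⟩
  · intro h W _ _ hCM hgo hns
    obtain ⟨W₁, i₁, i₂, hiso, hb, ha⟩ := h W hCM hgo hns
    exact ⟨W₁, i₁, i₂, hiso, ha, hb⟩

/-- By-name sanity: the tree's registered-road consumer type. The lead's text feeds any door stated on the certificate text. [folklore] -/
theorem cert_of_lead (h : Lead.R) : Cert.R := lead_iff_cert.mp h

/-- THE LANDED TREE DECL IS THE VETTED DRAFT TEXT, definitionally. [folklore] -/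
theorem landed_iff_lead :
    Summit.BirchSwinnertonDyer.BirchSwinnertonDyer.Theorems.SteinbergFibreAtTwo.RelaxedZetaOptimalAtTwoExistsMemberFlat ↔ Lead.R :=
  Iff.rfl

/-- Hence the landed tree decl is equivalent to crux-triage r1-2's certified text (Cert39b §1 / Cert42 §1). [folklore] -/
theorem landed_iff_cert :
    Summit.BirchSwinnertonDyer.BirchSwinnertonDyer.Theorems.SteinbergFibreAtTwo.RelaxedZetaOptimalAtTwoExistsMemberFlat ↔ Cert.R :=
  landed_iff_lead.trans lead_iff_cert

#print axioms landed_iff_lead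
#print axioms landed_iff_cert

end Summit.BirchSwinnertonDyer.BirchSwinnertonDyer.Cruxes.OrdKatoHalfAtTwoIso.VetLanded

end
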